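import Summits.PneNP.PneNP.Theorems.ChebyshevTracialDesignLevelAttenuation
import Summits.PneNP.PneNP.Theorems.ChebyshevTracialDesignAlignedDipoleDominance
import HarnessLib

/-!
# Cell pnp-psdrank, route `ChebyshevTracialDesign`: tight dominance with constant ONE, and the sharp attenuation of
# every level kernel on every even layer

Harmonic backbone of the crux `TracialDecayExp20` (stmt-PneNP-19878), eng g8 (second lineage for prover g6's bricks 11–12,
whose `bimodeCoeff_abs_mul_le` carries a factor `(1+ρ_c)^κ`; here the factor is removed):
* `bimodeCoeff_abs_mul_le_sharp` — for `κ ≤ l`, `m ≤ l`, `2l + 2 ≤ N` (cut size `t = 2l+1 ≤ N − 1`; false at `t = N`):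
  `|σ̃_{2κ}(l−m)| · T(N; 1, l) ≤ σ̃_{2κ}(l) · T(N; 2m+1, l−m)`, i.e. `|s_κ(c)| ≤ s_κ(1)` EXACTLY for the normalised level profile.
  Mechanism: evaluate both sides on the reference matching ALIGNED with the standard dipoles, where the level sums obey the two-term
  recursion dominated by the tight level (`…AlignedDipoleDominance.aligned_level_sum_dominance`, induction on `κ`, step inequality
  `(c−1)(2N−2c−1) ≥ 0`), and identify them with `σ̃ · Π_χ(M₀)` by prover g5/g6's closed form (`level_column_sum_zeta_eq_difference`).
* `kernelEigen_level_le_sharp` — brick 12 with the factor gone: for `n` even, `t = 2c+1`, `2t + 2 ≤ n`, `κ' ≤ c`, `m ≤ c`: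
  `kernelEigen n t (2κ') κ_m ≤ kernelEigen n t 0 κ_m · Π_{i<κ'} (2i+1)/(n−2i)` — (ATT) of R1-SKELETON S3(iii) at EVERY level with the
  TIGHT-level constant, all layers. [cite: Rothvoss2017, §2 (PDF p. 6)] [cite: GodsilMeagher2015, §15.2 (perfect matching scheme)]
[cite: Filmus2016, Def. 2.2 (arXiv p. 4)] Stature: support/instrument. WHAT THIS IS NOT: not virtual positivity, not (L2)/SNT,
nothing on psd rank, no P-vs-NP content. No definitions. Supports crux stmt-PneNP-19878.
-/

set_option linter.dupNamespace false -- `Summit.PneNP.PneNP.…`: summit = sub-problem (D-0017)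

noncomputable section

namespace Summit.PneNP.PneNP.Theorems.ChebyshevTracialDesignLevelDominanceSharp

open Finset Literature.Combinatorics.AssociationSchemes Literature.Combinatorics.AssociationSchemes.JohnsonHarmonics
open Literature.Combinatorics.AssociationSchemes.JohnsonSpectrum
open Literature.Barriers.PneNP
open Summit.PneNP.PneNP.Theorems.ChebyshevTracialDesignTightColumnSums
open Summit.PneNP.PneNP.Theorems.ChebyshevTracialDesignTightOddLayers
open Summit.PneNP.PneNP.Theorems.ChebyshevTracialDesignSaturatedSubsets
open Summit.PneNP.PneNP.Theorems.ChebyshevTracialDesignLevelDifference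
open Summit.PneNP.PneNP.Theorems.ChebyshevTracialDesignLevelAttenuation
open Summit.PneNP.PneNP.Theorems.ChebyshevTracialDesignTightEvenProduct
open Summit.PneNP.PneNP.Theorems.ChebyshevTracialDesignTightEigenDecay
open Summit.PneNP.PneNP.Theorems.ChebyshevTracialDesignJunta
open Summit.PneNP.PneNP.Theorems.ChebyshevTracialDesignAlignedDipoleRecursion
open Summit.PneNP.PneNP.Theorems.ChebyshevTracialDesignAlignedDipoleDominance

variable {n : ℕ}

/-! ### §1 A perfect matching containing prescribed parallel blocks -/

/-- **Block matchings extend**: for `n` even and `2K ≤ n` there is a perfect matching of `Fin n` containing the `K` edges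
`{v, v+K}`, `v < K`. [folklore] -/
theorem exists_pmatch_with_blocks (hn : Even n) {K : ℕ} (hK : 2 * K ≤ n) :
    ∃ M : PMatch n, ∀ (v : ℕ) (hv : v < K), s((⟨v, by omega⟩ : Fin n), (⟨v + K, by omega⟩ : Fin n)) ∈ M.1 := by
  classical
  -- the blocks and their one-edge matchings
  set P : Fin K → Finset (Fin n) := fun v => {⟨v.1, by omega⟩, ⟨v.1 + K, by omega⟩} with hP
  set f : Fin K → Finset (Sym2 (Fin n)) := fun v => {s((⟨v.1, by omega⟩ : Fin n), ⟨v.1 + K, by omega⟩)} with hf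
  have hPd : ∀ v w : Fin K, v ≠ w → Disjoint (P v) (P w) := by
    intro v w hvw
    rw [hP]
    simp only [disjoint_insert_left, disjoint_singleton_left, mem_insert, mem_singleton, Fin.mk.injEq, not_or]
    have : v.1 ≠ w.1 := fun h => hvw (Fin.ext h)
    refine ⟨⟨?_, ?_⟩, ?_, ?_⟩ <;> omega
  have hf1 : ∀ v ∈ (univ : Finset (Fin K)), IsPMOn (P v) (f v) := fun v _ =>
    IsPMOn.pair (by simp only [ne_eq, Fin.mk.injEq]; have := v.2; omega)
  have hM₁ : IsPMOn ((univ : Finset (Fin K)).biUnion P) ((univ : Finset (Fin K)).biUnion f) :=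
    isPMOn_biUnion P hPd univ f hf1
  -- the rest of the vertices
  set Q : Finset (Fin n) := (univ : Finset (Fin K)).biUnion P with hQ
  have hQcard : Q.card = 2 * K := by
    rw [hQ, card_biUnion (fun v _ w _ hvw => hPd v w hvw), sum_congr rfl (fun v _ =>
      card_pair (by simp only [ne_eq, Fin.mk.injEq]; have := v.2; omega)), sum_const, card_univ, Fintype.card_fin,
      smul_eq_mul, mul_comm]
  have heven : Even ((univ : Finset (Fin n)) \ Q).card := by
    rw [card_sdiff_of_subset (subset_univ Q), card_univ, Fintype.card_fin, hQcard]
    obtain ⟨k, hk⟩ := hn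
    exact ⟨k - K, by omega⟩
  obtain ⟨M₂, hM₂⟩ := exists_isPMOn_of_even _ ((univ : Finset (Fin n)) \ Q) rfl heven
  have hM : IsPMOn (univ : Finset (Fin n)) ((univ : Finset (Fin K)).biUnion f ∪ M₂) := by
    rw [← union_sdiff_of_subset (subset_univ Q)]
    exact hM₁.union hM₂ disjoint_sdiff
  refine ⟨⟨_, hM⟩, fun v hv => ?_⟩
  refine mem_union_left _ (mem_biUnion.2 ⟨⟨v, hv⟩, mem_univ _, ?_⟩)
  rw [hf]
  exact mem_singleton_self _

/-! ### §2 The level classes of the route in the junta vocabulary -/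

/-- The level class "`2m+1` crossing, `e` internal edges" of the junta files (`cutCount` on the edge set) is the class
"`(2m+1+2e)`-sets with `e` inner keys" of bricks 7–10. -/
theorem levelClass_eq_filter_innerKeys (M : PMatch n) (m e : ℕ) :
    (univ : Finset (Fin n)).powerset.filter (fun U =>
        (M.1.filter fun e' => cutCount U e' = 1).card = 2 * m + 1 ∧ (M.1.filter fun e' => cutCount U e' = 2).card = e) =
      (powersetCard (2 * m + 1 + 2 * e) (univ : Finset (Fin n))).filter
        (fun U => (U.filter fun x => x < M.2.partner x ∧ M.2.partner x ∈ U).card = e) := by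
  classical
  rw [← filter_cross_eq_filter_innerKeys M (2 * m + 1) e]
  ext U
  simp only [mem_filter, mem_powersetCard, mem_powerset, subset_univ, true_and]
  have hcard := card_eq_cr_add_two_mul_in M.2 (subset_univ U)
  constructor
  · rintro ⟨hr, he⟩
    have hUc : U.card = 2 * m + 1 + 2 * e := by omega
    have hodd : Odd U.card := ⟨m + e, by omega⟩
    have hcc : (U.filter fun x => M.2.partner x ∉ U).card = (M.1.filter fun e' => cutCount U e' = 1).card := by
      rw [← cc_eq_card_filter_partner ⟨U, hodd⟩ M, cc_eq_card_filter ⟨U, hodd⟩ M]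
    exact ⟨hUc, by rw [hcc]; exact hr⟩
  · rintro ⟨hUc, hr⟩
    have hodd : Odd U.card := ⟨m + e, by omega⟩
    have hcc : (U.filter fun x => M.2.partner x ∉ U).card = (M.1.filter fun e' => cutCount U e' = 1).card := by
      rw [← cc_eq_card_filter_partner ⟨U, hodd⟩ M, cc_eq_card_filter ⟨U, hodd⟩ M]
    rw [hcc] at hr
    exact ⟨hr, by omega⟩

/-! ### §3 Tight dominance with constant one -/

/-- **The tight level dominates, with constant one.** For `κ ≤ l`, `m ≤ l`, `2l + 2 ≤ N`, the closed-form bi-mode coefficients of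
brick 10 satisfy `|σ̃_{2κ}(l−m)| · T(N; 1, l) ≤ σ̃_{2κ}(l) · T(N; 2m+1, l−m)` where `σ̃_{2κ}(l) = T(N−2κ; 1, l−κ)` — i.e. the
level profile normalised by the level-class sizes is largest in absolute value at the tight level (prover g6's
`bimodeCoeff_abs_mul_le` without the factor `(1+ρ)^κ`; second, independent lineage: two-term recursion + induction, eng g8).
[cite: Rothvoss2017, §2 (PDF p. 6)] [cite: GodsilMeagher2015, §15.2 (perfect matching scheme)] -/
theorem bimodeCoeff_abs_mul_le_sharp (N l κ m : ℕ) (hκl : κ ≤ l) (hml : m ≤ l) (hlN : 2 * l + 2 ≤ N) :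
    |∑ e' ∈ range (l - κ + 1), (if e' ≤ l - m then
        (-1 : ℝ) ^ (κ - (l - m - e')) * (κ.choose (l - m - e') : ℝ) *
          (((N - 2 * κ).choose (2 * (l - κ) + 1 - 2 * e' + e') *
              (2 * (l - κ) + 1 - 2 * e' + e').choose e' * 2 ^ (2 * (l - κ) + 1 - 2 * e') : ℕ) : ℝ)
        else 0)| * ((N.choose (1 + l) * (1 + l).choose l * 2 ^ 1 : ℕ) : ℝ) ≤
      (((N - 2 * κ).choose (1 + (l - κ)) * (1 + (l - κ)).choose (l - κ) * 2 ^ 1 : ℕ) : ℝ) *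
        ((N.choose (2 * m + 1 + (l - m)) * (2 * m + 1 + (l - m)).choose (l - m) * 2 ^ (2 * m + 1) : ℕ) : ℝ) := by
  classical
  -- ambient vertex set `Fin n`, `n = 2N`
  set n : ℕ := 2 * N with hn2
  have hn : Even n := ⟨N, by omega⟩
  have hN : n / 2 = N := by omega
  have ht : 2 * (2 * l + 1) ≤ n := by omega
  have hκn : 4 * κ + 2 ≤ n := by omega
  -- the standard dipoles of the layer `2κ`
  obtain ⟨ha, hb, hab⟩ := standardDipoles_props (n := n) (j := 2 * κ) (by omega)
  set a : Fin (2 * κ) → Fin n := fun i => ⟨2 * i.1, by omega⟩ with ha_def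
  set b : Fin (2 * κ) → Fin n := fun i => ⟨2 * i.1 + 1, by omega⟩ with hb_def
  have hp := isHarmonic_dipoleVec ha hb hab
  -- the reference matching ALIGNED with them: blocks `{v, v + 2κ}`, `v < 2κ`
  obtain ⟨M₀, hM₀⟩ := exists_pmatch_with_blocks hn (K := 2 * κ) (by omega)
  have hcardM : M₀.1.card = N := by have := two_mul_card_pmatch M₀; omega
  -- the aligned family as total functions: heads `x_j = 2j`, `x'_j = 2κ+2j`, tails `y_j = 2j+1`, `y'_j = 2κ+2j+1`
  set x : ℕ → Fin n := fun j => ⟨min (2 * j) (n - 1), by omega⟩ with hx_def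
  set y : ℕ → Fin n := fun j => ⟨min (2 * j + 1) (n - 1), by omega⟩ with hy_def
  set x' : ℕ → Fin n := fun j => ⟨min (2 * (κ + j)) (n - 1), by omega⟩ with hx'_def
  set y' : ℕ → Fin n := fun j => ⟨min (2 * (κ + j) + 1) (n - 1), by omega⟩ with hy'_def
  have hxv : ∀ j, j < κ → (x j).1 = 2 * j := fun j hj => by simp only [hx_def]; omega
  have hyv : ∀ j, j < κ → (y j).1 = 2 * j + 1 := fun j hj => by simp only [hy_def]; omega
  have hx'v : ∀ j, j < κ → (x' j).1 = 2 * j + 2 * κ := fun j hj => by simp only [hx'_def]; omega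
  have hy'v : ∀ j, j < κ → (y' j).1 = 2 * j + 1 + 2 * κ := fun j hj => by simp only [hy'_def]; omega
  have hxM : ∀ j < κ, s(x j, x' j) ∈ M₀.1 := fun j hj => by
    rw [show x j = ⟨2 * j, by omega⟩ from Fin.ext (hxv j hj),
      show x' j = ⟨2 * j + 2 * κ, by omega⟩ from Fin.ext (hx'v j hj)]; exact hM₀ (2 * j) (by omega)
  have hyM : ∀ j < κ, s(y j, y' j) ∈ M₀.1 := fun j hj => by
    rw [show y j = ⟨2 * j + 1, by omega⟩ from Fin.ext (hyv j hj),
      show y' j = ⟨2 * j + 1 + 2 * κ, by omega⟩ from Fin.ext (hy'v j hj)]; exact hM₀ (2 * j + 1) (by omega)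
  have hxinj : ∀ j < κ, ∀ j' < κ, s(x j, x' j) = s(x j', x' j') → j = j' := by
    intro j hj j' hj' h
    rcases Sym2.eq_iff.1 h with ⟨h1, -⟩ | ⟨h1, -⟩
    · have := congrArg Fin.val h1; rw [hxv j hj, hxv j' hj'] at this; omega
    · have := congrArg Fin.val h1; rw [hxv j hj, hx'v j' hj'] at this; omega
  have hyinj : ∀ j < κ, ∀ j' < κ, s(y j, y' j) = s(y j', y' j') → j = j' := by
    intro j hj j' hj' h
    rcases Sym2.eq_iff.1 h with ⟨h1, -⟩ | ⟨h1, -⟩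
    · have := congrArg Fin.val h1; rw [hyv j hj, hyv j' hj'] at this; omega
    · have := congrArg Fin.val h1; rw [hyv j hj, hy'v j' hj'] at this; omega
  have hxy : ∀ j < κ, ∀ j' < κ, s(x j, x' j) ≠ s(y j', y' j') := by
    intro j hj j' hj' h
    rcases Sym2.eq_iff.1 h with ⟨h1, -⟩ | ⟨h1, -⟩
    · have := congrArg Fin.val h1; rw [hxv j hj, hyv j' hj'] at this; omega
    · have := congrArg Fin.val h1; rw [hxv j hj, hy'v j' hj'] at this; omega
  -- the dipole product of `χ_{a,b}` IS the aligned product `Φ_κ`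
  have hΦ : ∀ U : Finset (Fin n),
      ∏ j ∈ range κ, ((if x j ∈ U then (1 : ℝ) else 0) - (if y j ∈ U then (1 : ℝ) else 0)) *
          ((if x' j ∈ U then (1 : ℝ) else 0) - (if y' j ∈ U then (1 : ℝ) else 0)) =
        zeta (dipoleVec (2 * κ) a b) U := by
    intro U
    rw [zeta_dipoleVec (2 * κ) a b ha hb hab U, prod_mul_distrib]
    have hg : ∀ i ∈ (univ : Finset (Fin (2 * κ))), ((if a i ∈ U then (1 : ℝ) else 0) - (if b i ∈ U then (1 : ℝ) else 0)) =
        (fun m : ℕ => (if x m ∈ U then (1 : ℝ) else 0) - (if y m ∈ U then (1 : ℝ) else 0)) i.1 := by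
      intro i _
      have e1 : a i = x i.1 := Fin.ext (by have := i.2; simp only [ha_def, hx_def]; omega)
      have e2 : b i = y i.1 := Fin.ext (by have := i.2; simp only [hb_def, hy_def]; omega)
      simp only [e1, e2]
    rw [prod_congr rfl hg, Fin.prod_univ_eq_prod_range
      (fun m : ℕ => (if x m ∈ U then (1 : ℝ) else 0) - (if y m ∈ U then (1 : ℝ) else 0)) (2 * κ), two_mul,
      prod_range_add]
  -- the two level sums of `Φ_κ` against `M₀`, in the closed form of brick 10
  set Q₀ : ℝ := ∑ T ∈ univ.filter (fun T : Finset (Fin n) => (T.filter fun z => M₀.2.partner z ∈ T).card = 2 * κ),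
    dipoleVec (2 * κ) a b T with hQ₀
  have hLc : ∑ U ∈ (univ : Finset (Fin n)).powerset.filter (fun U =>
        (M₀.1.filter fun e => cutCount U e = 1).card = 2 * m + 1 ∧ (M₀.1.filter fun e => cutCount U e = 2).card = l - m),
        ∏ j ∈ range κ, ((if x j ∈ U then (1 : ℝ) else 0) - (if y j ∈ U then (1 : ℝ) else 0)) *
          ((if x' j ∈ U then (1 : ℝ) else 0) - (if y' j ∈ U then (1 : ℝ) else 0)) =
      (∑ e' ∈ range (l - κ + 1), (if e' ≤ l - m then
        (-1 : ℝ) ^ (κ - (l - m - e')) * (κ.choose (l - m - e') : ℝ) *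
          (((n / 2 - 2 * κ).choose (2 * (l - κ) + 1 - 2 * e' + e') *
              (2 * (l - κ) + 1 - 2 * e' + e').choose e' * 2 ^ (2 * (l - κ) + 1 - 2 * e') : ℕ) : ℝ)
        else 0)) * Q₀ := by
    rw [levelClass_eq_filter_innerKeys M₀ m (l - m), show 2 * m + 1 + 2 * (l - m) = 2 * l + 1 by omega,
      sum_congr rfl (fun U _ => hΦ U)]
    exact level_column_sum_zeta_eq_difference (partner_invol M₀).1 (partner_invol M₀).2 hκl ht hp
  have hL1 : ∑ U ∈ (univ : Finset (Fin n)).powerset.filter (fun U =>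
        (M₀.1.filter fun e => cutCount U e = 1).card = 1 ∧ (M₀.1.filter fun e => cutCount U e = 2).card = l),
        ∏ j ∈ range κ, ((if x j ∈ U then (1 : ℝ) else 0) - (if y j ∈ U then (1 : ℝ) else 0)) *
          ((if x' j ∈ U then (1 : ℝ) else 0) - (if y' j ∈ U then (1 : ℝ) else 0)) =
      (∑ e' ∈ range (l - κ + 1), (if e' ≤ l then
        (-1 : ℝ) ^ (κ - (l - e')) * (κ.choose (l - e') : ℝ) *
          (((n / 2 - 2 * κ).choose (2 * (l - κ) + 1 - 2 * e' + e') *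
              (2 * (l - κ) + 1 - 2 * e' + e').choose e' * 2 ^ (2 * (l - κ) + 1 - 2 * e') : ℕ) : ℝ)
        else 0)) * Q₀ := by
    have h01 := levelClass_eq_filter_innerKeys M₀ 0 l
    rw [Nat.mul_zero, Nat.zero_add, show 1 + 2 * l = 2 * l + 1 by ring] at h01
    rw [h01, sum_congr rfl (fun U _ => hΦ U)]
    exact level_column_sum_zeta_eq_difference (partner_invol M₀).1 (partner_invol M₀).2 hκl ht hp
  rw [hN] at hLc hL1
  -- abbreviations
  set Sm : ℝ := ∑ e' ∈ range (l - κ + 1), (if e' ≤ l - m then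
      (-1 : ℝ) ^ (κ - (l - m - e')) * (κ.choose (l - m - e') : ℝ) *
        (((N - 2 * κ).choose (2 * (l - κ) + 1 - 2 * e' + e') *
            (2 * (l - κ) + 1 - 2 * e' + e').choose e' * 2 ^ (2 * (l - κ) + 1 - 2 * e') : ℕ) : ℝ)
      else 0) with hSm
  set S1 : ℝ := ∑ e' ∈ range (l - κ + 1), (if e' ≤ l then
      (-1 : ℝ) ^ (κ - (l - e')) * (κ.choose (l - e') : ℝ) *
        (((N - 2 * κ).choose (2 * (l - κ) + 1 - 2 * e' + e') *
            (2 * (l - κ) + 1 - 2 * e' + e').choose e' * 2 ^ (2 * (l - κ) + 1 - 2 * e') : ℕ) : ℝ)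
      else 0) with hS1
  set R0 : ℝ := (((N - 2 * κ).choose (1 + (l - κ)) * (1 + (l - κ)).choose (l - κ) * 2 ^ 1 : ℕ) : ℝ) with hR0
  set U0 : ℝ := ((N.choose (1 + l) * (1 + l).choose l * 2 ^ 1 : ℕ) : ℝ) with hU0
  set Um : ℝ := ((N.choose (2 * m + 1 + (l - m)) * (2 * m + 1 + (l - m)).choose (l - m) * 2 ^ (2 * m + 1) : ℕ) : ℝ)
    with hUm
  -- the tight coefficient is the single surviving term `R0 > 0`
  have hS1R0 : S1 = R0 := by
    rw [hS1, sum_eq_single_of_mem (l - κ) (mem_range.2 (by omega))]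
    · rw [if_pos (Nat.sub_le l κ), show l - (l - κ) = κ by omega, Nat.sub_self, pow_zero, Nat.choose_self, Nat.cast_one,
        one_mul, one_mul, show 2 * (l - κ) + 1 - 2 * (l - κ) = 1 by omega, hR0]
    · intro e' he' hne
      have he'c : e' < l - κ := by have := mem_range.1 he'; omega
      rw [if_pos (by omega), Nat.choose_eq_zero_of_lt (by omega : κ < l - e')]; simp
  have hR0pos : 0 < R0 := by
    rw [hR0]; push_cast
    have h1 : 0 < (((N - 2 * κ).choose (1 + (l - κ)) : ℕ) : ℝ) := by exact_mod_cast Nat.choose_pos (by omega)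
    have h2 : 0 < (((1 + (l - κ)).choose (l - κ) : ℕ) : ℝ) := by exact_mod_cast Nat.choose_pos (by omega)
    positivity
  -- the combinatorial core (eng g8, `…AlignedDipoleDominance` / `…AlignedDipoleRecursion`) on `M₀`
  have hdomA := aligned_level_sum_dominance x x' y y' κ M₀.2 hxM hyM hxinj hyinj hxy (2 * m + 1) (l - m) l
    (by omega) hκl (by rw [hcardM]; omega)
  have htightA := aligned_level_sum_tight x x' y y' κ M₀.2 hxM hyM hxinj hyinj hxy l hκl
  rw [hLc, hL1, card_filter_cr_in_eq M₀.2, card_filter_cr_in_eq M₀.2, hcardM] at hdomA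
  rw [← hU0, ← hUm, hS1R0] at hdomA
  rw [hL1, hcardM, ← hR0, hS1R0] at htightA
  -- `R0 · Q₀ = 2^κ · R0`, so `Q₀ > 0`
  have hQpos : 0 < Q₀ := by
    have h2 : (0 : ℝ) < (2 : ℝ) ^ κ * R0 := by positivity
    have : R0 * Q₀ = (2 : ℝ) ^ κ * R0 := by rw [htightA]
    nlinarith [hR0pos]
  -- `|Sm · Q₀| · U0 ≤ (R0 · Q₀) · Um`; cancel `Q₀`
  rw [abs_mul, abs_of_pos hQpos] at hdomA
  have key : (|Sm| * U0) * Q₀ ≤ (R0 * Um) * Q₀ := by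
    calc (|Sm| * U0) * Q₀ = |Sm| * Q₀ * U0 := by ring
      _ ≤ R0 * Q₀ * Um := hdomA
      _ = (R0 * Um) * Q₀ := by ring
  exact le_of_mul_le_mul_right key hQpos

/-- Squared form of `bimodeCoeff_abs_mul_le_sharp` (the shape consumed by the spectral conversion). -/
theorem bimodeCoeff_sq_mul_le_sharp (N l κ m : ℕ) (hκl : κ ≤ l) (hml : m ≤ l) (hlN : 2 * l + 2 ≤ N) :
    (∑ e' ∈ range (l - κ + 1), (if e' ≤ l - m then
        (-1 : ℝ) ^ (κ - (l - m - e')) * (κ.choose (l - m - e') : ℝ) *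
          (((N - 2 * κ).choose (2 * (l - κ) + 1 - 2 * e' + e') *
              (2 * (l - κ) + 1 - 2 * e' + e').choose e' * 2 ^ (2 * (l - κ) + 1 - 2 * e') : ℕ) : ℝ)
        else 0)) ^ 2 * ((N.choose (1 + l) * (1 + l).choose l * 2 ^ 1 : ℕ) : ℝ) ^ 2 ≤
      (((N - 2 * κ).choose (1 + (l - κ)) * (1 + (l - κ)).choose (l - κ) * 2 ^ 1 : ℕ) : ℝ) ^ 2 *
        ((N.choose (2 * m + 1 + (l - m)) * (2 * m + 1 + (l - m)).choose (l - m) * 2 ^ (2 * m + 1) : ℕ) : ℝ) ^ 2 := by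
  have h := bimodeCoeff_abs_mul_le_sharp N l κ m hκl hml hlN
  have h0 : 0 ≤ |∑ e' ∈ range (l - κ + 1), (if e' ≤ l - m then
        (-1 : ℝ) ^ (κ - (l - m - e')) * (κ.choose (l - m - e') : ℝ) *
          (((N - 2 * κ).choose (2 * (l - κ) + 1 - 2 * e' + e') *
              (2 * (l - κ) + 1 - 2 * e' + e').choose e' * 2 ^ (2 * (l - κ) + 1 - 2 * e') : ℕ) : ℝ)
        else 0)| * ((N.choose (1 + l) * (1 + l).choose l * 2 ^ 1 : ℕ) : ℝ) := by positivity
  have h2 := pow_le_pow_left₀ h0 h 2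
  rw [mul_pow, mul_pow, sq_abs] at h2
  exact h2

/-! ### §4 The sharp attenuation of every level kernel on every even layer -/

/-- **(ATT) at every level with the tight-level constant.** For `n` even, `t = 2c+1` with `2t + 2 ≤ n`, `κ' ≤ c`, `m ≤ c`,
with `κ₁` the Gram class function of the tight incidence and `κ_m` that of the level-`(2m+1)` incidence on the `t`-sets:
`kernelEigen n t (2κ') κ_m ≤ kernelEigen n t 0 κ_m · Π_{i<κ'} (2i+1)/(n−2i)` — prover g6's `kernelEigen_level_le` (brick 12) with
the factor `((1+ρ)^{κ'})²` replaced by `1`, i.e. `σ_{2κ'}(c) ≤ σ_{2κ'}(1)` for the normalised singular values of EVERY level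
relation. [cite: Rothvoss2017, §2 (PDF p. 6)] [cite: GodsilMeagher2015, §15.2 (perfect matching scheme)]
[cite: BrouwerHaemers2012, Prop. 4.3.2 (PDF p. 83)] -/
theorem kernelEigen_level_le_sharp {c κ' m : ℕ} (hn : Even n) (ht : 2 * (2 * c + 1) + 2 ≤ n) (hκc : κ' ≤ c) (hmc : m ≤ c)
    (κ₁ κm : ℕ → ℝ)
    (hA1 : ∀ U ∈ univ.powersetCard (2 * c + 1), ∀ U' ∈ univ.powersetCard (2 * c + 1),
      ∑ M : PMatch n, (if (U.filter fun x => M.2.partner x ∉ U).card = 1 then (1 : ℝ) else 0) *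
        (if (U'.filter fun x => M.2.partner x ∉ U').card = 1 then (1 : ℝ) else 0) = κ₁ (U ∩ U').card)
    (hAm : ∀ U ∈ univ.powersetCard (2 * c + 1), ∀ U' ∈ univ.powersetCard (2 * c + 1),
      ∑ M : PMatch n, (if (U.filter fun x => M.2.partner x ∉ U).card = 2 * m + 1 then (1 : ℝ) else 0) *
        (if (U'.filter fun x => M.2.partner x ∉ U').card = 2 * m + 1 then (1 : ℝ) else 0) = κm (U ∩ U').card) :
    kernelEigen n (2 * c + 1) (2 * κ') κm ≤
      kernelEigen n (2 * c + 1) 0 κm * ∏ i ∈ range κ', ((2 * i + 1 : ℝ) / ((n : ℝ) - 2 * i)) := by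
  classical
  have ht' : 2 * (2 * c + 1) ≤ n := by omega
  have hcN : 2 * c + 2 ≤ n / 2 := by obtain ⟨k, hk⟩ := hn; omega
  -- the four ingredients (prover g6's proportionality and tight product bound; the sharp dominance of §3)
  have hprop := kernelEigen_level_mul_eq ht' hκc hmc κ₁ κm hA1 hAm
  have hdom := bimodeCoeff_sq_mul_le_sharp (n / 2) c κ' m hκc hmc hcN
  have htight := kernelEigen_tight_even_le_prod hn ht' hκc κ₁ hA1
  have h1nn : 0 ≤ kernelEigen n (2 * c + 1) (2 * κ') κ₁ := kernelEigen_tight_even_nonneg hn ht' hκc κ₁ hA1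
  -- abbreviations
  set S1 : ℝ := ∑ e' ∈ range (c - κ' + 1), (if e' ≤ c then
      (-1 : ℝ) ^ (κ' - (c - e')) * (κ'.choose (c - e') : ℝ) *
        (((n / 2 - 2 * κ').choose (2 * (c - κ') + 1 - 2 * e' + e') *
            (2 * (c - κ') + 1 - 2 * e' + e').choose e' * 2 ^ (2 * (c - κ') + 1 - 2 * e') : ℕ) : ℝ)
      else 0) with hS1
  set Sm : ℝ := ∑ e' ∈ range (c - κ' + 1), (if e' ≤ c - m then
      (-1 : ℝ) ^ (κ' - (c - m - e')) * (κ'.choose (c - m - e') : ℝ) *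
        (((n / 2 - 2 * κ').choose (2 * (c - κ') + 1 - 2 * e' + e') *
            (2 * (c - κ') + 1 - 2 * e' + e').choose e' * 2 ^ (2 * (c - κ') + 1 - 2 * e') : ℕ) : ℝ)
      else 0) with hSm
  set R0 : ℝ := (((n / 2 - 2 * κ').choose (1 + (c - κ')) * (1 + (c - κ')).choose (c - κ') * 2 ^ 1 : ℕ) : ℝ) with hR0
  set U0 : ℝ := (((n / 2).choose (1 + c) * (1 + c).choose c * 2 ^ 1 : ℕ) : ℝ) with hU0
  set Um : ℝ := (((n / 2).choose (2 * m + 1 + (c - m)) * (2 * m + 1 + (c - m)).choose (c - m) * 2 ^ (2 * m + 1) : ℕ) : ℝ)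
    with hUm
  set P : ℝ := ∏ i ∈ range κ', ((2 * i + 1 : ℝ) / ((n : ℝ) - 2 * i)) with hP
  -- the tight coefficient `S1` is the single surviving term `R0 > 0`
  have hS1R0 : S1 = R0 := by
    rw [hS1, sum_eq_single_of_mem (c - κ') (mem_range.2 (by omega))]
    · rw [if_pos (Nat.sub_le c κ'), show c - (c - κ') = κ' by omega, Nat.sub_self, pow_zero, Nat.choose_self, Nat.cast_one,
        one_mul, one_mul, show 2 * (c - κ') + 1 - 2 * (c - κ') = 1 by omega, hR0]
    · intro e' he' hne
      have he'c : e' < c - κ' := by have := mem_range.1 he'; omega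
      rw [if_pos (by omega), Nat.choose_eq_zero_of_lt (by omega : κ' < c - e')]; simp
  have hR0pos : 0 < R0 := by
    rw [hR0]; push_cast
    have h1 : 0 < (((n / 2 - 2 * κ').choose (1 + (c - κ')) : ℕ) : ℝ) := by exact_mod_cast Nat.choose_pos (by omega)
    have h2 : 0 < (((1 + (c - κ')).choose (c - κ') : ℕ) : ℝ) := by exact_mod_cast Nat.choose_pos (by omega)
    positivity
  have hU0pos : 0 < U0 := by
    rw [hU0]; push_cast
    have h1 : 0 < (((n / 2).choose (1 + c) : ℕ) : ℝ) := by exact_mod_cast Nat.choose_pos (by omega)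
    have h2 : 0 < (((1 + c).choose c : ℕ) : ℝ) := by exact_mod_cast Nat.choose_pos (by omega)
    positivity
  -- column and row sums, `λ₀ = d_R d_C`, handshake (as in brick 12)
  have hcolm : ∀ M : PMatch n, ∑ U ∈ univ.powersetCard (2 * c + 1),
      (if (U.filter fun x => M.2.partner x ∉ U).card = 2 * m + 1 then (1 : ℝ) else 0) = Um :=
    fun M => level_colSum_eq ⟨m, rfl⟩ (by omega) M
  have hcol1 : ∀ M : PMatch n, ∑ U ∈ univ.powersetCard (2 * c + 1),
      (if (U.filter fun x => M.2.partner x ∉ U).card = 1 then (1 : ℝ) else 0) = U0 :=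
    fun M => level_colSum_eq ⟨0, rfl⟩ (by omega) M
  obtain ⟨U₁, hU₁⟩ : ∃ U : Finset (Fin n), U ∈ univ.powersetCard (2 * c + 1) := by
    have : (univ.powersetCard (2 * c + 1) : Finset (Finset (Fin n))).Nonempty := by
      apply powersetCard_nonempty.2; rw [card_univ, Fintype.card_fin]; omega
    exact this
  have hU₁t : U₁.card = 2 * c + 1 := (mem_powersetCard.1 hU₁).2
  have hrowm := fun U hU => level_rowSum_eq (t := 2 * c + 1) (r := 2 * m + 1) κm hAm (U := U) hU
  have hrow1 := fun U hU => level_rowSum_eq (t := 2 * c + 1) (r := 1) κ₁ hA1 (U := U) hU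
  have hl0m := kernelEigen_zero_eq_rowSum_mul_colSum _ κm hAm hcolm hU₁t (hrowm U₁ hU₁)
  have hl01 := kernelEigen_zero_eq_rowSum_mul_colSum _ κ₁ hA1 hcol1 hU₁t (hrow1 U₁ hU₁)
  have hhm := choose_mul_rowSum_eq_card_mul_colSum _ hcolm hrowm
  have hh1 := choose_mul_rowSum_eq_card_mul_colSum _ hcol1 hrow1
  -- assemble: `λ_m · S1² · U0² ≤ λ₁ · S1² · Um² ≤ λ₀(κ₁)·P·S1²·Um²` and `λ₀(κ₁)·Um² = λ₀(κ_m)·U0²`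
  have hCnt : 0 < (n.choose (2 * c + 1) : ℝ) := by exact_mod_cast Nat.choose_pos (by omega)
  have step1 : kernelEigen n (2 * c + 1) (2 * κ') κm * S1 ^ 2 * U0 ^ 2 ≤
      kernelEigen n (2 * c + 1) (2 * κ') κ₁ * (S1 ^ 2 * Um ^ 2) := by
    rw [hprop, mul_assoc]
    refine mul_le_mul_of_nonneg_left ?_ h1nn
    rw [hS1R0]
    exact hdom
  have step2 : kernelEigen n (2 * c + 1) (2 * κ') κ₁ * (S1 ^ 2 * Um ^ 2) ≤
      kernelEigen n (2 * c + 1) 0 κ₁ * P * (S1 ^ 2 * Um ^ 2) :=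
    mul_le_mul_of_nonneg_right htight (by positivity)
  have hswap : kernelEigen n (2 * c + 1) 0 κ₁ * Um ^ 2 = kernelEigen n (2 * c + 1) 0 κm * U0 ^ 2 := by
    have e1 : kernelEigen n (2 * c + 1) 0 κ₁ * Um ^ 2 * (n.choose (2 * c + 1) : ℝ) =
        (Fintype.card (PMatch n) : ℝ) * U0 ^ 2 * Um ^ 2 := by
      rw [hl01]
      calc κ₁ (2 * c + 1) * U0 * Um ^ 2 * (n.choose (2 * c + 1) : ℝ)
          = ((n.choose (2 * c + 1) : ℝ) * κ₁ (2 * c + 1)) * U0 * Um ^ 2 := by ring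
        _ = _ := by rw [hh1]; ring
    have e2 : kernelEigen n (2 * c + 1) 0 κm * U0 ^ 2 * (n.choose (2 * c + 1) : ℝ) =
        (Fintype.card (PMatch n) : ℝ) * U0 ^ 2 * Um ^ 2 := by
      rw [hl0m]
      calc κm (2 * c + 1) * Um * U0 ^ 2 * (n.choose (2 * c + 1) : ℝ)
          = ((n.choose (2 * c + 1) : ℝ) * κm (2 * c + 1)) * Um * U0 ^ 2 := by ring
        _ = _ := by rw [hhm]; ring
    exact mul_right_cancel₀ hCnt.ne' (e1.trans e2.symm)
  have step3 : kernelEigen n (2 * c + 1) 0 κ₁ * P * (S1 ^ 2 * Um ^ 2) =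
      (kernelEigen n (2 * c + 1) 0 κm * P) * (S1 ^ 2 * U0 ^ 2) := by
    calc kernelEigen n (2 * c + 1) 0 κ₁ * P * (S1 ^ 2 * Um ^ 2)
        = (kernelEigen n (2 * c + 1) 0 κ₁ * Um ^ 2) * (P * S1 ^ 2) := by ring
      _ = (kernelEigen n (2 * c + 1) 0 κm * U0 ^ 2) * (P * S1 ^ 2) := by rw [hswap]
      _ = _ := by ring
  have hpos : 0 < S1 ^ 2 * U0 ^ 2 := by rw [hS1R0]; positivity
  have := (step1.trans step2).trans_eq step3
  rw [show kernelEigen n (2 * c + 1) (2 * κ') κm * S1 ^ 2 * U0 ^ 2 =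
      kernelEigen n (2 * c + 1) (2 * κ') κm * (S1 ^ 2 * U0 ^ 2) by ring] at this
  exact le_of_mul_le_mul_right this hpos

end Summit.PneNP.PneNP.Theorems.ChebyshevTracialDesignLevelDominanceSharp
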